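import Summits.CriticalPhenomena.PercolationContinuityZ3.Theorems.FK.BoxLimitJointSemicontinuity
import Summits.CriticalPhenomena.PercolationContinuityZ3.Theorems.FK.ClusterDensityContinuity
import HarnessLib

/-!
# FK-continuity cell, FO-10a: at a point of uniqueness `φ⁰_{p₀,q₀} = φ¹_{p₀,q₀}` the cluster densities `κ^b(p,q)` are
# JOINTLY continuous in `(p,q)` (Grimmett 2006, Prop. (4.28) in the vector `(p,q)`, transferred to `|C_x|⁻¹` as in (4.84))

Registered R118 (cell INBOX l.7669, 2026-08-25); registry row FO-10a-g343; label STR-B (coordinator fk-4 g231).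
Cell `fk-continuity` (bschramm), row FO-10a (pressure layer); support file for the FK-continuity transplant
(`--supports stmt-CriticalPhenomena-4575`); builds on p205010 (kernel theorem, internal audit signed; external expert
review pending). Pure proofs; no definitions, no named facts, no sorries; every `d ≥ 1`. UNCONDITIONAL; it decides
nothing about FH / TP_FK / WHERE `φ⁰ = φ¹` holds or the value of `κ^b`.

`ClusterDensityContinuity.lean` transfers limits ALONG A FILTER OF `p`'S (fixed `q`) from increasing local events to
`κ^b = ∫ |C_x|⁻¹ dφ^b` (uniform `1/N` proxies). The same transfer along a filter of PAIRS `(p,q)`, fed with the joint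
continuity of every increasing local probability at a point of uniqueness (`BoxLimitJointSemicontinuity.lean`), gives:

* `tendsto_integral_inv_ncard_rcLimit_of_forall_local_pair` — the transfer lemma along any filter on `ℝ × ℝ`
  eventually inside `[0,1] × [1,∞)`;
* **`continuousWithinAt_integral_inv_ncard_rcLimit_of_eq`** — if `φ⁰_{p₀,q₀} = φ¹_{p₀,q₀}` then for both `b`,
  `(p,q) ↦ κ^b(p,q) = ∫ |C_x|⁻¹ dφ^b_{p,q}` is continuous within `[0,1] × [1,∞)` at `(p₀,q₀)`;
* **`lowerSemicontinuousWithinAt_integral_inv_ncard_rcLimit_true`**, **`upperSemicontinuousWithinAt_integral_inv_ncard_rcLimit_false`**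
  — everywhere on `[0,1] × [1,∞)`: `κ¹` is LOWER and `κ⁰` UPPER semicontinuous in the vector `(p,q)` (uniform `1/N`
  approximation by finite combinations of the semicontinuous local-proxy probabilities).

## References

* G. Grimmett, *The Random-Cluster Model*, Springer 2006 (`book:grimmett2006-random-cluster-model`): Prop. (4.28)
  [PDF pp. 79–80], §4.5 (4.84), Thm. (4.63)(b). [Grimmett2006]
-/

noncomputable section

open MeasureTheory Set Filter Finset
open scoped Topology ENNReal

namespace Summit.CriticalPhenomena.PercolationContinuityZ3.Theorems.FK

open Literature.Probability.Percolation Literature.Probability.LatticeModels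

variable {d : ℕ}

/-- **Transfer of `(p,q)`-limits from increasing local events to the cluster density.** If along a filter `l` on
`ℝ × ℝ` (eventually inside `[0,1] × [1,∞)`) every increasing local probability `φ^b_{t}(A)` tends to `φ^{b'}_{(p,q)}(A)`,
then `∫ |C_x|⁻¹ dφ^b_t → ∫ |C_x|⁻¹ dφ^{b'}_{(p,q)}` (uniform `1/N` approximation through the local proxies of
`{|C_x| ≥ k}`, as in `ClusterDensityContinuity`). [cite: Grimmett2006, Prop. (4.28) with (4.84)] -/
theorem tendsto_integral_inv_ncard_rcLimit_of_forall_local_pair {p q : ℝ} (hp : p ∈ Set.Icc (0 : ℝ) 1) (hq : 1 ≤ q)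
    (x : Site d) {b b' : Bool} {l : Filter (ℝ × ℝ)} (hl : ∀ᶠ t in l, t.1 ∈ Set.Icc (0 : ℝ) 1 ∧ 1 ≤ t.2)
    (hloc : ∀ (A : Set (BondConfig (Site d))) (F : Finset (Sym2 (Site d))), IsUpperSet A → DeterminedBy A ↑F →
      Tendsto (fun t : ℝ × ℝ => (rcLimit d b t.1 t.2).real A) l (𝓝 ((rcLimit d b' p q).real A))) :
    Tendsto (fun t : ℝ × ℝ => ∫ ω, ((openCluster ω x).ncard : ℝ)⁻¹ ∂(rcLimit d b t.1 t.2)) l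
      (𝓝 (∫ ω, ((openCluster ω x).ncard : ℝ)⁻¹ ∂(rcLimit d b' p q))) := by
  have hq0 : 0 < q := one_pos.trans_le hq
  set m := siteRad x with hm
  have hxm : x ∈ box d m := mem_box_iff_siteRad_le.2 le_rfl
  set B : ℕ → Set (BondConfig (Site d)) := fun k =>
    {ω | (k : ℕ∞) ≤ (openCluster (ω ∩ ↑(edgesIn (zdGraph d) (box d (m + k)))) x).encard} with hB
  have hBeq : ∀ (c : Bool) {t s : ℝ}, t ∈ Set.Icc (0 : ℝ) 1 → 1 ≤ s → ∀ k,
      (rcLimit d c t s).real (clusterSizeGe x k) = (rcLimit d c t s).real (B k) := fun c t s ht hs k =>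
    measureReal_clusterSizeGe_eq_of_ae_subset
      ((isBoxLimit_rcLimit c ht hs).ae_subset_edgeSet ht (one_pos.trans_le hs)) hxm k
  refine tendsto_of_forall_eventually_approx fun ε hε => ?_
  obtain ⟨N, hN⟩ := exists_nat_one_div_lt hε
  have hN1 : (1 : ℝ) / ((N + 1 : ℕ) : ℝ) ≤ ε := by push_cast; exact hN.le
  refine ⟨fun t => 1 - ∑ k ∈ Finset.Icc 2 (N + 1), (rcLimit d b t.1 t.2).real (B k) / (((k : ℝ) - 1) * k),
    1 - ∑ k ∈ Finset.Icc 2 (N + 1), (rcLimit d b' p q).real (B k) / (((k : ℝ) - 1) * k), ?_, ?_, ?_⟩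
  · refine tendsto_const_nhds.sub (tendsto_finsetSum _ fun k _ => ?_)
    exact (hloc _ _ (isUpperSet_le_encard_openCluster_inter x m k) (determinedBy_le_encard_openCluster_inter x m k)).div_const _
  · filter_upwards [hl] with t htI
    haveI := isProbabilityMeasure_rcLimit b t.1 t.2 (d := d)
    have h := abs_integral_inv_ncard_sub_le (rcLimit d b t.1 t.2) x (N + 1) (by omega)
    simp_rw [hBeq b htI.1 htI.2] at h
    exact h.trans hN1
  · haveI := isProbabilityMeasure_rcLimit b' p q (d := d)
    have h := abs_integral_inv_ncard_sub_le (rcLimit d b' p q) x (N + 1) (by omega)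
    simp_rw [hBeq b' hp hq] at h
    exact h.trans hN1

/-- **At a point of uniqueness the cluster densities are jointly continuous in `(p,q)`**: if
`φ⁰_{p₀,q₀} = φ¹_{p₀,q₀}` (`d ≥ 1`, `p₀ ∈ [0,1]`, `q₀ ≥ 1`) then for `b ∈ {0,1}` and every site `x`,
`(p,q) ↦ κ^b(p,q) = ∫ |C_x|⁻¹ dφ^b_{p,q}` is continuous within `[0,1] × [1,∞)` at `(p₀,q₀)`.
[cite: Grimmett2006, Prop. (4.28)(b),(c) with (4.84) and Thm. (4.63)(b)] -/
theorem continuousWithinAt_integral_inv_ncard_rcLimit_of_eq (hd : 0 < d) {p₀ q₀ : ℝ} (hp₀ : p₀ ∈ Set.Icc (0 : ℝ) 1)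
    (hq₀ : 1 ≤ q₀) (heq : rcLimit d false p₀ q₀ = rcLimit d true p₀ q₀) (b : Bool) (x : Site d) :
    ContinuousWithinAt (fun t : ℝ × ℝ => ∫ ω, ((openCluster ω x).ncard : ℝ)⁻¹ ∂(rcLimit d b t.1 t.2))
      (Set.Icc (0 : ℝ) 1 ×ˢ Set.Ici (1 : ℝ)) (p₀, q₀) := by
  refine tendsto_integral_inv_ncard_rcLimit_of_forall_local_pair hp₀ hq₀ x
    (l := 𝓝[Set.Icc (0 : ℝ) 1 ×ˢ Set.Ici (1 : ℝ)] (p₀, q₀)) ?_ fun A F hAu hA => ?_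
  · filter_upwards [self_mem_nhdsWithin] with t ht
    exact ⟨(Set.mem_prod.1 ht).1, Set.mem_Ici.1 (Set.mem_prod.1 ht).2⟩
  · exact continuousWithinAt_rcLimit_real_of_eq hd hp₀ hq₀ heq b hA hAu

/-! ### Joint semicontinuity of `κ¹` (lower) and `κ⁰` (upper) in `(p,q)` -/

/-- A nonnegative multiple of an upper semicontinuous real function is upper semicontinuous (within a set, at a point).
[folklore] -/
theorem upperSemicontinuousWithinAt_const_mul {α : Type*} [TopologicalSpace α] {f : α → ℝ} {s : Set α} {x : α}
    (hf : UpperSemicontinuousWithinAt f s x) {c : ℝ} (hc : 0 ≤ c) :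
    UpperSemicontinuousWithinAt (fun z => c * f z) s x := by
  intro y hy
  have hy' : c * f x < y := hy
  rcases hc.eq_or_lt with rfl | hc0
  · refine Eventually.of_forall fun z => ?_
    simp only [zero_mul] at hy' ⊢
    exact hy'
  · have h1 : f x < y / c := by rwa [lt_div_iff₀ hc0, mul_comm]
    filter_upwards [hf (y / c) h1] with z hz
    show c * f z < y
    have h2 : f z < y / c := hz
    rwa [lt_div_iff₀ hc0, mul_comm] at h2

/-- A nonnegative multiple of a lower semicontinuous real function is lower semicontinuous (within a set, at a point).
[folklore] -/
theorem lowerSemicontinuousWithinAt_const_mul {α : Type*} [TopologicalSpace α] {f : α → ℝ} {s : Set α} {x : α}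
    (hf : LowerSemicontinuousWithinAt f s x) {c : ℝ} (hc : 0 ≤ c) :
    LowerSemicontinuousWithinAt (fun z => c * f z) s x := by
  intro y hy
  have hy' : y < c * f x := hy
  rcases hc.eq_or_lt with rfl | hc0
  · refine Eventually.of_forall fun z => ?_
    simp only [zero_mul] at hy' ⊢
    exact hy'
  · have h1 : y / c < f x := by rwa [div_lt_iff₀ hc0, mul_comm]
    filter_upwards [hf (y / c) h1] with z hz
    show y < c * f z
    have h2 : y / c < f z := hz
    rwa [div_lt_iff₀ hc0, mul_comm] at h2

/-- **`κ¹(p,q) = ∫ |C_x|⁻¹ dφ¹_{p,q}` is LOWER semicontinuous in the vector `(p,q) ∈ [0,1] × [1,∞)`** (`d ≥ 1`):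
`κ¹ = 1 − Σ_k φ¹(|C_x| ≥ k)/((k−1)k)` uniformly in `(p,q)` (tail `≤ 1/N`), each `φ¹(|C_x| ≥ k)` being the probability of
an increasing LOCAL proxy event, hence upper semicontinuous in `(p,q)` (Prop. (4.28)(b), vector form). In particular
`κ¹` is left-continuous in `p` and right-… — the one-variable clauses are the tree's `ClusterDensityContinuity` /
`PressureQDerivatives`. [cite: Grimmett2006, Prop. (4.28)(b) with (4.84)] -/
theorem lowerSemicontinuousWithinAt_integral_inv_ncard_rcLimit_true (hd : 0 < d) (x : Site d) {p₀ q₀ : ℝ}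
    (hp₀ : p₀ ∈ Set.Icc (0 : ℝ) 1) (hq₀ : 1 ≤ q₀) :
    LowerSemicontinuousWithinAt (fun t : ℝ × ℝ => ∫ ω, ((openCluster ω x).ncard : ℝ)⁻¹ ∂(rcLimit d true t.1 t.2))
      (Set.Icc (0 : ℝ) 1 ×ˢ Set.Ici (1 : ℝ)) (p₀, q₀) := by
  intro y hy
  set S := Set.Icc (0 : ℝ) 1 ×ˢ Set.Ici (1 : ℝ) with hS
  set κ : ℝ × ℝ → ℝ := fun t => ∫ ω, ((openCluster ω x).ncard : ℝ)⁻¹ ∂(rcLimit d true t.1 t.2) with hκ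
  set m := siteRad x with hm
  have hxm : x ∈ box d m := mem_box_iff_siteRad_le.2 le_rfl
  set B : ℕ → Set (BondConfig (Site d)) := fun k =>
    {ω | (k : ℕ∞) ≤ (openCluster (ω ∩ ↑(edgesIn (zdGraph d) (box d (m + k)))) x).encard} with hB
  have hBeq : ∀ {t s : ℝ}, t ∈ Set.Icc (0 : ℝ) 1 → 1 ≤ s → ∀ k,
      (rcLimit d true t s).real (clusterSizeGe x k) = (rcLimit d true t s).real (B k) := fun ht hs k =>
    measureReal_clusterSizeGe_eq_of_ae_subset
      ((isBoxLimit_rcLimit true ht hs).ae_subset_edgeSet ht (one_pos.trans_le hs)) hxm k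
  -- uniform approximation by the partial sums
  have hε : 0 < (κ (p₀, q₀) - y) / 3 := by simp only [hκ] at hy ⊢; linarith
  obtain ⟨N, hN⟩ := exists_nat_one_div_lt hε
  have hN1 : (1 : ℝ) / ((N + 1 : ℕ) : ℝ) ≤ (κ (p₀, q₀) - y) / 3 := by push_cast; exact hN.le
  set P : ℝ × ℝ → ℝ := fun t => ∑ k ∈ Finset.Icc 2 (N + 1), (1 / (((k : ℝ) - 1) * k)) * (rcLimit d true t.1 t.2).real (B k)
    with hP
  have happrox : ∀ t : ℝ × ℝ, t.1 ∈ Set.Icc (0 : ℝ) 1 → 1 ≤ t.2 → |κ t - (1 - P t)| ≤ (κ (p₀, q₀) - y) / 3 := by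
    intro t ht1 ht2
    haveI := isProbabilityMeasure_rcLimit true t.1 t.2 (d := d)
    have h := abs_integral_inv_ncard_sub_le (rcLimit d true t.1 t.2) x (N + 1) (by omega)
    simp_rw [hBeq ht1 ht2] at h
    have hPt : P t = ∑ k ∈ Finset.Icc 2 (N + 1), (rcLimit d true t.1 t.2).real (B k) / (((k : ℝ) - 1) * k) :=
      Finset.sum_congr rfl fun k _ => by rw [one_div, inv_mul_eq_div]
    rw [hPt]
    exact h.trans hN1
  -- the partial sum is upper semicontinuous (each term is, by Prop. (4.28)(b) in the vector)
  have hPusc : UpperSemicontinuousWithinAt P S (p₀, q₀) := by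
    refine upperSemicontinuousWithinAt_sum fun k hk => ?_
    have hk2 : 2 ≤ k := (Finset.mem_Icc.1 hk).1
    refine upperSemicontinuousWithinAt_const_mul
      (upperSemicontinuousWithinAt_rcLimit_true_real hd (determinedBy_le_encard_openCluster_inter x m k)
        (isUpperSet_le_encard_openCluster_inter x m k) hp₀ hq₀) ?_
    have : (1 : ℝ) ≤ (k : ℝ) - 1 := by
      have : (2 : ℝ) ≤ k := by exact_mod_cast hk2
      linarith
    positivity
  have hev := hPusc (P (p₀, q₀) + (κ (p₀, q₀) - y) / 3) (by linarith)
  filter_upwards [hev, self_mem_nhdsWithin] with t ht htS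
  have h0 := happrox (p₀, q₀) hp₀ hq₀
  have h1 := happrox t (Set.mem_prod.1 htS).1 (Set.mem_Ici.1 (Set.mem_prod.1 htS).2)
  rw [abs_le] at h0 h1
  show y < κ t
  linarith [h0.1, h0.2, h1.1, h1.2]

/-- **`κ⁰(p,q) = ∫ |C_x|⁻¹ dφ⁰_{p,q}` is UPPER semicontinuous in the vector `(p,q) ∈ [0,1] × [1,∞)`**: the same
approximation with the lower semicontinuous `φ⁰`-probabilities of the increasing local proxies (Prop. (4.28)(c)).
[cite: Grimmett2006, Prop. (4.28)(c) with (4.84)] -/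
theorem upperSemicontinuousWithinAt_integral_inv_ncard_rcLimit_false (x : Site d) {p₀ q₀ : ℝ}
    (hp₀ : p₀ ∈ Set.Icc (0 : ℝ) 1) (hq₀ : 1 ≤ q₀) :
    UpperSemicontinuousWithinAt (fun t : ℝ × ℝ => ∫ ω, ((openCluster ω x).ncard : ℝ)⁻¹ ∂(rcLimit d false t.1 t.2))
      (Set.Icc (0 : ℝ) 1 ×ˢ Set.Ici (1 : ℝ)) (p₀, q₀) := by
  intro y hy
  set S := Set.Icc (0 : ℝ) 1 ×ˢ Set.Ici (1 : ℝ) with hS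
  set κ : ℝ × ℝ → ℝ := fun t => ∫ ω, ((openCluster ω x).ncard : ℝ)⁻¹ ∂(rcLimit d false t.1 t.2) with hκ
  set m := siteRad x with hm
  have hxm : x ∈ box d m := mem_box_iff_siteRad_le.2 le_rfl
  set B : ℕ → Set (BondConfig (Site d)) := fun k =>
    {ω | (k : ℕ∞) ≤ (openCluster (ω ∩ ↑(edgesIn (zdGraph d) (box d (m + k)))) x).encard} with hB
  have hBeq : ∀ {t s : ℝ}, t ∈ Set.Icc (0 : ℝ) 1 → 1 ≤ s → ∀ k,
      (rcLimit d false t s).real (clusterSizeGe x k) = (rcLimit d false t s).real (B k) := fun ht hs k =>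
    measureReal_clusterSizeGe_eq_of_ae_subset
      ((isBoxLimit_rcLimit false ht hs).ae_subset_edgeSet ht (one_pos.trans_le hs)) hxm k
  have hε : 0 < (y - κ (p₀, q₀)) / 3 := by simp only [hκ] at hy ⊢; linarith
  obtain ⟨N, hN⟩ := exists_nat_one_div_lt hε
  have hN1 : (1 : ℝ) / ((N + 1 : ℕ) : ℝ) ≤ (y - κ (p₀, q₀)) / 3 := by push_cast; exact hN.le
  set P : ℝ × ℝ → ℝ := fun t => ∑ k ∈ Finset.Icc 2 (N + 1), (1 / (((k : ℝ) - 1) * k)) * (rcLimit d false t.1 t.2).real (B k)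
    with hP
  have happrox : ∀ t : ℝ × ℝ, t.1 ∈ Set.Icc (0 : ℝ) 1 → 1 ≤ t.2 → |κ t - (1 - P t)| ≤ (y - κ (p₀, q₀)) / 3 := by
    intro t ht1 ht2
    haveI := isProbabilityMeasure_rcLimit false t.1 t.2 (d := d)
    have h := abs_integral_inv_ncard_sub_le (rcLimit d false t.1 t.2) x (N + 1) (by omega)
    simp_rw [hBeq ht1 ht2] at h
    have hPt : P t = ∑ k ∈ Finset.Icc 2 (N + 1), (rcLimit d false t.1 t.2).real (B k) / (((k : ℝ) - 1) * k) :=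
      Finset.sum_congr rfl fun k _ => by rw [one_div, inv_mul_eq_div]
    rw [hPt]
    exact h.trans hN1
  have hPlsc : LowerSemicontinuousWithinAt P S (p₀, q₀) := by
    refine lowerSemicontinuousWithinAt_sum fun k hk => ?_
    have hk2 : 2 ≤ k := (Finset.mem_Icc.1 hk).1
    refine lowerSemicontinuousWithinAt_const_mul
      (lowerSemicontinuousWithinAt_rcLimit_false_real (d := d) (determinedBy_le_encard_openCluster_inter x m k)
        (isUpperSet_le_encard_openCluster_inter x m k) hp₀ hq₀) ?_
    have : (1 : ℝ) ≤ (k : ℝ) - 1 := by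
      have : (2 : ℝ) ≤ k := by exact_mod_cast hk2
      linarith
    positivity
  have hev := hPlsc (P (p₀, q₀) - (y - κ (p₀, q₀)) / 3) (by linarith)
  filter_upwards [hev, self_mem_nhdsWithin] with t ht htS
  have h0 := happrox (p₀, q₀) hp₀ hq₀
  have h1 := happrox t (Set.mem_prod.1 htS).1 (Set.mem_Ici.1 (Set.mem_prod.1 htS).2)
  rw [abs_le] at h0 h1
  show κ t < y
  linarith [h0.1, h0.2, h1.1, h1.2]

end Summit.CriticalPhenomena.PercolationContinuityZ3.Theorems.FK

end
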